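import Summits.ResolutionOfSingularities.ResolutionOfSingularities.Theorems.EquisingularLiftEquisingularLiftNatGoodPointFinish
import HarnessLib

/-!
# [OURS · L1 W4.5(b) · EL♮] THE POINT-EXIT CUT WITH PIECE B1 DISCHARGED
# (crux `EquisingularLiftNat` = stmt-ResolutionOfSingularities-20038; the corollaries of Theorems/EquisingularLiftEquisingularLiftNatPointExit.lean
# (res-L1-w45b-strat-1, p529105) with their hypothesis `GoodPointFinish p` supplied by `goodPointFinish_holds` (p533178))

HONEST FRAMING. OURS (cell res-hironaka, crux chain w45b, slot W4.5(b)); NOT a statement of any manuscript; replaces the role of NOTHING in the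
manuscript; AI-written, AI review is weaker than expert review. Helper `--supports stmt-ResolutionOfSingularities-20038 --as helper` by
res-L1-w45b-lead-1. No `sorry`; standard axioms. Pure logic over landed theorems — importable one-liners so the lead and the planners can cite
the UNCONDITIONAL forms by name.

* `geFourFinishIsolated_of_geFourReachExitIsolated` — B2 ⟹ the registered residual stub text `GeFourFinishIsolated p` (v11 `stub_elnat_ge_four_finish`).
* `geFourFinishIsolated_iff_geFourReachExitIsolated` — the registered residual stub IS «reach an exit» on the band, unconditionally.
* `geFourHoriz_of_geFourReachExit` / `stub_elnat_ge_four_of_geFourReachExit` — the band from «reach an exit from the start».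
* `equisingularLiftNat_of_reachExit` — THE CRUX BY NAME from `∀ p, ReachExit p` alone.
* `equisingularLiftNat_of_upToThree_of_reach_of_reachExit` — the crux by name from the `n ≤ 3` band, piece A and piece B2.

References: Theorems/EquisingularLiftEquisingularLiftNatPointExit.lean (the cut), …NatGoodPointFinish.lean (B1).
-/

set_option linter.dupNamespace false -- mandated namespace `Summit.<Summit>.<Problem>` of this single-conjunct summit

noncomputable section

open Summit.ResolutionOfSingularities.ResolutionOfSingularities.Theorems.EquisingularLiftNatBands
open Summit.ResolutionOfSingularities.ResolutionOfSingularities.Theorems.EquisingularLiftNatResidualCut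
open Summit.ResolutionOfSingularities.ResolutionOfSingularities.Theorems.EquisingularLiftNatStageCut
open Summit.ResolutionOfSingularities.ResolutionOfSingularities.Theorems.EquisingularLiftNatPointExit
open Summit.ResolutionOfSingularities.ResolutionOfSingularities.Cruxes.EquisingularLiftNat.Sections

namespace Summit.ResolutionOfSingularities.ResolutionOfSingularities.Theorems.EquisingularLiftNatPointExit

/-- **B2 ⟹ the registered residual stub** `GeFourFinishIsolated p` (`stub_elnat_ge_four_finish_of_exit` with B1 discharged). [folklore] -/
theorem geFourFinishIsolated_of_geFourReachExitIsolated (p : ℕ) (hB2 : GeFourReachExitIsolated p) : GeFourFinishIsolated p :=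
  stub_elnat_ge_four_finish_of_exit p (goodPointFinish_holds p) hB2

/-- **THE REGISTERED RESIDUAL STUB IS «REACH AN EXIT», unconditionally**: `GeFourFinishIsolated p ↔ GeFourReachExitIsolated p`. [folklore] -/
theorem geFourFinishIsolated_iff_geFourReachExitIsolated (p : ℕ) : GeFourFinishIsolated p ↔ GeFourReachExitIsolated p :=
  geFourFinishIsolated_iff_geFourReachExitIsolated_of_goodPointFinish p (goodPointFinish_holds p)

/-- The horizontal residual `GeFourHoriz p` from «reach an exit from the start» on the band (B1 discharged). [folklore] -/
theorem geFourHoriz_of_geFourReachExit (p : ℕ) (hE : GeFourReachExit p) : GeFourHoriz p :=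
  geFourHoriz_of_reachExit p hE (goodPointFinish_holds p)

/-- The registered band text (`stub_elnat_ge_four`) from «reach an exit from the start» alone (B1 discharged). [folklore] -/
theorem stub_elnat_ge_four_of_geFourReachExit (p : ℕ) (hE : GeFourReachExit p) :
    p.Prime → ∀ (k : Type) [Field k] [CharP k p] [IsAlgClosed k] (n : ℕ) (H : AlgebraicGeometry.Scheme.{0}) (ι : H ⟶ (Literature.AlgebraicGeometry.Motives.projectiveSpace n k).left), AlgebraicGeometry.IsClosedImmersion ι → AlgebraicGeometry.IsIntegral H → (∀ y : (Literature.AlgebraicGeometry.Motives.projectiveSpace n k).left, ∃ U : (Literature.AlgebraicGeometry.Motives.projectiveSpace n k).left.affineOpens, y ∈ (U : (Literature.AlgebraicGeometry.Motives.projectiveSpace n k).left.Opens) ∧ (ι.ker.ideal U).IsPrincipal) → 4 ≤ n → Summit.ResolutionOfSingularities.ResolutionOfSingularities.Theorems.EquisingularLift.ELNatAt p k n H ι :=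
  stub_elnat_ge_four_of_reachExit p hE (goodPointFinish_holds p)

/-- **THE CRUX BY NAME FROM «REACH AN EXIT» ALONE** (every `p`, every `n`; B1 discharged). [folklore] -/
theorem equisingularLiftNat_of_reachExit (hE : ∀ p : ℕ, ReachExit p) :
    Summit.ResolutionOfSingularities.ResolutionOfSingularities.Theses.EquisingularLift.EquisingularLiftNat :=
  equisingularLiftNat_of_reachExit_of_goodPointFinish hE goodPointFinish_holds

/-- **The crux BY NAME from the band `n ≤ 3`, piece A and piece B2 on the residual band** (B1 discharged). [folklore] -/
theorem equisingularLiftNat_of_upToThree_of_reach_of_reachExit (h3 : ∀ p : ℕ, UpToThree p) (hA : ∀ p : ℕ, GeFourReachIsolated p)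
    (hB2 : ∀ p : ℕ, GeFourReachExitIsolated p) :
    Summit.ResolutionOfSingularities.ResolutionOfSingularities.Theses.EquisingularLift.EquisingularLiftNat :=
  equisingularLiftNat_of_upToThree_of_reach_exit h3 hA hB2 goodPointFinish_holds

end Summit.ResolutionOfSingularities.ResolutionOfSingularities.Theorems.EquisingularLiftNatPointExit

end
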